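import Mathlib
import Summits.Ventures.PercRepro.PuncturedLYMSplitCount

/-!
# PercRepro — THE RATIO LEMMA: MEMBER COLUMNS PER ROW INCREASE WITH THE LEVEL
(p10, gen 38)

For a family `𝒞` of members on a ground set `S` write `r t = #rowsOf S t 𝒞` (the `t`-subsets containing no member) and
`q t = #punct S (t+1) 𝒞` (the `(t+1)`-subsets containing a member).  THEOREM (`card_punct_mul_card_rowsOf_le`):
**`q t · r (t+1) ≤ q (t+1) · r t`** whenever no `(t+2)`-subset of `S` contains two distinct members — the ratio `q/r`
increases with the level.  PROOF: double count the triples `((Y, Z), z)` with `Y` a touched `(t+1)`-set, `Z` an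
untouched `(t+1)`-set and `z ∈ Z ∖ Y`, with the weight `1/(t + 1 − #(Y ∩ Z))`: summing over `z` first gives exactly `1`
per pair `(Y, Z)` (`#(Z ∖ Y) = t + 1 − #(Y ∩ Z)`); the map `((Y, Z), z) ↦ (insert z Y, Z.erase z)` lands in the pairs
`(Y', Z')` of a touched `(t+2)`-set and an untouched `t`-set and preserves `Y ∩ Z`, and each fibre has at most
`#(Y' ∖ Z') − 1 = t + 1 − #(Y' ∩ Z')` elements: the fibre injects into `Y' ∖ Z'` by `z`, and the point `z₀ ∈ C ∖ Z'`
of THE member `C ⊆ Y'` is never hit (`Y' ∖ z₀` contains no member).  Hence the weighted count is at most the number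
of pairs `(Y', Z')`.  This is the hypothesis `hq` of `NodeArith.second_family` for the other members of a node of the
fibration recursion (`ratio_chain`: the adjacent steps chain to every pair of levels).  Nothing here asserts (SP).
-/

namespace PercRepro.PuncturedLYM.Split

open Finset

variable {α : Type} [DecidableEq α]

section Ratio

variable {S : Finset α} {𝒞 : Finset (Finset α)} {t : ℕ}

/-- The pairs (touched `(t+1)`-set, untouched `(t+1)`-set). -/
def ratioL (S : Finset α) (𝒞 : Finset (Finset α)) (t : ℕ) : Finset (Finset α × Finset α) :=
  punct S (t + 1) 𝒞 ×ˢ rowsOf S (t + 1) 𝒞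

/-- The pairs (touched `(t+2)`-set, untouched `t`-set). -/
def ratioR (S : Finset α) (𝒞 : Finset (Finset α)) (t : ℕ) : Finset (Finset α × Finset α) :=
  punct S (t + 2) 𝒞 ×ˢ rowsOf S t 𝒞

/-- The triples `((Y, Z), z)` with `(Y, Z) ∈ ratioL` and `z ∈ Z ∖ Y`. -/
def ratioE (S : Finset α) (𝒞 : Finset (Finset α)) (t : ℕ) : Finset ((Finset α × Finset α) × α) :=
  (ratioL S 𝒞 t ×ˢ S).filter (fun e => e.2 ∈ e.1.2 ∧ e.2 ∉ e.1.1)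

/-- The move: `((Y, Z), z) ↦ (insert z Y, Z.erase z)`. -/
def ratioMove (e : (Finset α × Finset α) × α) : Finset α × Finset α :=
  (insert e.2 e.1.1, e.1.2.erase e.2)

/-- The weight `1 / (t + 1 − #(Y ∩ Z))`. -/
def ratioW (t : ℕ) (e : (Finset α × Finset α) × α) : ℚ :=
  1 / ((t + 1 : ℚ) - ((e.1.1 ∩ e.1.2).card : ℚ))

/-- Membership in the triples. -/
theorem mem_ratioE {e : (Finset α × Finset α) × α} :
    e ∈ ratioE S 𝒞 t ↔ (e.1 ∈ ratioL S 𝒞 t ∧ e.2 ∈ S) ∧ e.2 ∈ e.1.2 ∧ e.2 ∉ e.1.1 := by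
  simp [ratioE, mem_filter, mem_product]

/-- A touched set and an untouched set of the same size differ somewhere. -/
theorem sdiff_nonempty_of_mem_ratioL {p : Finset α × Finset α} (hp : p ∈ ratioL S 𝒞 t) : (p.2 \ p.1).Nonempty := by
  rw [ratioL, mem_product, mem_punct, mem_rowsOf] at hp
  obtain ⟨⟨⟨_, hYc⟩, C, hC, hCY⟩, ⟨_, hZc⟩, hZ⟩ := hp
  by_contra h
  rw [not_nonempty_iff_eq_empty, sdiff_eq_empty_iff_subset] at h
  have heq : p.2 = p.1 := eq_of_subset_of_card_le h (by omega)
  exact hZ C hC (heq ▸ hCY)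

/-- `#(Z ∖ Y) = t + 1 − #(Y ∩ Z)` for `(Y, Z) ∈ ratioL`. -/
theorem card_sdiff_of_mem_ratioL {p : Finset α × Finset α} (hp : p ∈ ratioL S 𝒞 t) :
    ((p.2 \ p.1).card : ℚ) = (t + 1 : ℚ) - ((p.1 ∩ p.2).card : ℚ) := by
  rw [ratioL, mem_product, mem_punct, mem_rowsOf] at hp
  obtain ⟨_, ⟨_, hZc⟩, _⟩ := hp
  have h1 := card_sdiff_add_card_inter p.2 p.1
  rw [inter_comm p.1 p.2]
  have h3 : ((p.2 \ p.1).card : ℚ) + ((p.2 ∩ p.1).card : ℚ) = (p.2.card : ℚ) := by exact_mod_cast h1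
  rw [hZc] at h3
  push_cast at h3
  linarith

/-- Summing the weight over the moves of a pair gives `1`. -/
theorem sum_ratioW_eq_one {p : Finset α × Finset α} (hp : p ∈ ratioL S 𝒞 t) :
    ∑ z ∈ p.2 \ p.1, ratioW t (p, z) = 1 := by
  have hne := sdiff_nonempty_of_mem_ratioL hp
  have hc := card_sdiff_of_mem_ratioL hp
  have hpos : (0 : ℚ) < (p.2 \ p.1).card := by exact_mod_cast card_pos.2 hne
  simp only [ratioW, sum_const, nsmul_eq_mul]
  rw [← hc]
  field_simp

/-- The weighted count of the triples is the number of pairs. -/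
theorem sum_ratioE_ratioW : ∑ e ∈ ratioE S 𝒞 t, ratioW t e = (ratioL S 𝒞 t).card := by
  unfold ratioE
  rw [sum_filter, sum_product]
  have hinner : ∀ p ∈ ratioL S 𝒞 t,
      (∑ z ∈ S, if z ∈ p.2 ∧ z ∉ p.1 then ratioW t (p, z) else 0) = 1 := by
    intro p hp
    rw [← sum_filter]
    have hfil : S.filter (fun z => z ∈ p.2 ∧ z ∉ p.1) = p.2 \ p.1 := by
      ext z
      rw [mem_filter, mem_sdiff]
      constructor
      · rintro ⟨_, h⟩; exact h
      · rintro ⟨hz2, hz1⟩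
        refine ⟨?_, hz2, hz1⟩
        rw [ratioL, mem_product, mem_rowsOf] at hp
        exact hp.2.1.1 hz2
    rw [hfil]
    exact sum_ratioW_eq_one hp
  rw [sum_congr rfl hinner, sum_const, nsmul_eq_mul, mul_one]

/-- The move lands in `ratioR`. -/
theorem ratioMove_mem {e : (Finset α × Finset α) × α} (he : e ∈ ratioE S 𝒞 t) : ratioMove e ∈ ratioR S 𝒞 t := by
  rw [mem_ratioE] at he
  obtain ⟨⟨hp, hzS⟩, hzZ, hzY⟩ := he
  rw [ratioL, mem_product, mem_punct, mem_rowsOf] at hp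
  obtain ⟨⟨⟨hYS, hYc⟩, C, hC, hCY⟩, ⟨hZS, hZc⟩, hZ⟩ := hp
  rw [ratioR, mem_product, mem_punct, mem_rowsOf, ratioMove]
  refine ⟨⟨⟨insert_subset hzS hYS, ?_⟩, C, hC, hCY.trans (subset_insert _ _)⟩, ⟨(erase_subset _ _).trans hZS, ?_⟩, ?_⟩
  · rw [card_insert_of_notMem hzY, hYc]
  · rw [card_erase_of_mem hzZ, hZc]; rfl
  · intro C' hC' hC'Z
    exact hZ C' hC' (hC'Z.trans (erase_subset _ _))

/-- The move preserves the intersection `Y ∩ Z`. -/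
theorem ratioMove_inter {e : (Finset α × Finset α) × α} (he : e ∈ ratioE S 𝒞 t) :
    (ratioMove e).1 ∩ (ratioMove e).2 = e.1.1 ∩ e.1.2 := by
  rw [mem_ratioE] at he
  obtain ⟨_, _, hzY⟩ := he
  rw [ratioMove]
  ext x
  simp only [mem_inter, mem_insert, mem_erase]
  constructor
  · rintro ⟨hx1, hx2, hx3⟩
    rcases hx1 with rfl | hx1
    · exact absurd rfl hx2
    · exact ⟨hx1, hx3⟩
  · rintro ⟨hx1, hx2⟩
    refine ⟨Or.inr hx1, ?_, hx2⟩
    rintro rfl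
    exact hzY hx1

/-- A triple is determined by its pair's image and its point. -/
theorem ratioMove_injOn_fiber {e e' : (Finset α × Finset α) × α} (he : e ∈ ratioE S 𝒞 t) (he' : e' ∈ ratioE S 𝒞 t)
    (hm : ratioMove e = ratioMove e') (hz : e.2 = e'.2) : e = e' := by
  rw [mem_ratioE] at he he'
  obtain ⟨_, hzZ, hzY⟩ := he
  obtain ⟨_, hzZ', hzY'⟩ := he'
  rw [ratioMove, ratioMove, Prod.mk.injEq] at hm
  obtain ⟨h1, h2⟩ := hm
  rw [← hz] at h1 h2 hzZ' hzY'
  have hY : e.1.1 = e'.1.1 := by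
    have := congrArg (fun s => s.erase e.2) h1
    simp only [erase_insert hzY, erase_insert hzY'] at this
    exact this
  have hZ : e.1.2 = e'.1.2 := by
    have := congrArg (fun s => insert e.2 s) h2
    simp only [insert_erase hzZ, insert_erase hzZ'] at this
    exact this
  exact Prod.ext (Prod.ext hY hZ) hz

/-- **The fibre bound.** If no `(t+2)`-subset of `S` contains two distinct members, the fibre of the move over a pair
`(Y', Z') ∈ ratioR` has at most `#(Y' ∖ Z') − 1` elements: it injects into `Y' ∖ Z'` by the point, and misses the
point `z₀ ∈ C ∖ Z'` of the member `C ⊆ Y'`. -/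
theorem card_fiber_le (hone : ∀ Y ⊆ S, Y.card = t + 2 → ∀ C ∈ 𝒞, ∀ C' ∈ 𝒞, C ⊆ Y → C' ⊆ Y → C = C')
    {p' : Finset α × Finset α} (hp' : p' ∈ ratioR S 𝒞 t) :
    ((ratioE S 𝒞 t).filter (fun e => ratioMove e = p')).card + 1 ≤ (p'.1 \ p'.2).card := by
  rw [ratioR, mem_product, mem_punct, mem_rowsOf] at hp'
  obtain ⟨⟨⟨hYS, hYc⟩, C, hC, hCY⟩, ⟨hZS, hZc⟩, hZ⟩ := hp'
  -- the bad point
  have hCZ : ¬ C ⊆ p'.2 := hZ C hC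
  obtain ⟨z₀, hz₀C, hz₀Z⟩ := not_subset.1 hCZ
  have hz₀ : z₀ ∈ p'.1 \ p'.2 := mem_sdiff.2 ⟨hCY hz₀C, hz₀Z⟩
  -- the fibre injects into `(Y' ∖ Z').erase z₀`
  have hmaps : Set.MapsTo (fun e : (Finset α × Finset α) × α => e.2)
      (((ratioE S 𝒞 t).filter (fun e => ratioMove e = p')) : Set ((Finset α × Finset α) × α))
      (((p'.1 \ p'.2).erase z₀ : Finset α) : Set α) := by
    intro e he
    rw [mem_coe, mem_filter] at he
    rw [mem_coe]
    obtain ⟨heE, hem⟩ := he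
    have heE' := heE
    rw [mem_ratioE] at heE'
    obtain ⟨⟨hp, _⟩, hzZ, hzY⟩ := heE'
    rw [ratioMove, Prod.ext_iff] at hem
    obtain ⟨h1, h2⟩ := hem
    simp only at h1 h2
    rw [mem_erase, mem_sdiff]
    refine ⟨?_, ?_, ?_⟩
    · -- `z ≠ z₀`: otherwise `Y = Y' ∖ z₀` would be touched
      rintro rfl
      rw [ratioL, mem_product, mem_punct] at hp
      obtain ⟨⟨_, C', hC', hC'Y⟩, _⟩ := hp
      have hC'Y' : C' ⊆ p'.1 := by rw [← h1]; exact hC'Y.trans (subset_insert _ _)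
      have := hone p'.1 hYS hYc C hC C' hC' hCY hC'Y'
      subst this
      exact hzY (hC'Y hz₀C)
    · rw [← h1]; exact mem_insert_self _ _
    · rw [← h2]; exact notMem_erase _ _
  have hinj : Set.InjOn (fun e : (Finset α × Finset α) × α => e.2)
      (((ratioE S 𝒞 t).filter (fun e => ratioMove e = p')) : Set ((Finset α × Finset α) × α)) := by
    intro e he e' he' hz
    simp only [coe_filter, Set.mem_setOf_eq] at he he'
    exact ratioMove_injOn_fiber he.1 he'.1 (he.2.trans he'.2.symm) hz
  have := card_le_card_of_injOn (fun e : (Finset α × Finset α) × α => e.2) hmaps hinj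
  rw [card_erase_of_mem hz₀] at this
  have hpos : 0 < (p'.1 \ p'.2).card := card_pos.2 ⟨z₀, hz₀⟩
  omega

/-- `#(Y' ∖ Z') = t + 2 − #(Y' ∩ Z')` for `(Y', Z') ∈ ratioR`. -/
theorem card_sdiff_of_mem_ratioR {p' : Finset α × Finset α} (hp' : p' ∈ ratioR S 𝒞 t) :
    ((p'.1 \ p'.2).card : ℚ) = (t + 2 : ℚ) - ((p'.1 ∩ p'.2).card : ℚ) := by
  rw [ratioR, mem_product, mem_punct, mem_rowsOf] at hp'
  obtain ⟨⟨⟨_, hYc⟩, _⟩, _⟩ := hp'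
  have h1 := card_sdiff_add_card_inter p'.1 p'.2
  have h3 : ((p'.1 \ p'.2).card : ℚ) + ((p'.1 ∩ p'.2).card : ℚ) = (p'.1.card : ℚ) := by exact_mod_cast h1
  rw [hYc] at h3
  push_cast at h3
  linarith

/-- The weighted count of a fibre is at most `1`. -/
theorem sum_fiber_ratioW_le_one (hone : ∀ Y ⊆ S, Y.card = t + 2 → ∀ C ∈ 𝒞, ∀ C' ∈ 𝒞, C ⊆ Y → C' ⊆ Y → C = C')
    {p' : Finset α × Finset α} (hp' : p' ∈ ratioR S 𝒞 t) :
    ∑ e ∈ (ratioE S 𝒞 t).filter (fun e => ratioMove e = p'), ratioW t e ≤ 1 := by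
  have hfib := card_fiber_le hone hp'
  have hsd := card_sdiff_of_mem_ratioR hp'
  -- every element of the fibre has the weight `1 / (t + 1 − #(Y' ∩ Z'))`
  have hw : ∀ e ∈ (ratioE S 𝒞 t).filter (fun e => ratioMove e = p'),
      ratioW t e = 1 / ((t + 1 : ℚ) - ((p'.1 ∩ p'.2).card : ℚ)) := by
    intro e he
    rw [mem_filter] at he
    rw [ratioW, ← he.2, ratioMove_inter he.1]
  rw [sum_congr rfl hw, sum_const, nsmul_eq_mul]
  set k := ((ratioE S 𝒞 t).filter (fun e => ratioMove e = p')).card with hk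
  have hk1 : (k : ℚ) + 1 ≤ (p'.1 \ p'.2).card := by exact_mod_cast hfib
  rw [hsd] at hk1
  have hden : (0 : ℚ) ≤ (t + 1 : ℚ) - ((p'.1 ∩ p'.2).card : ℚ) := by linarith
  rcases hden.lt_or_eq with hlt | heq
  · rw [mul_one_div, div_le_one hlt]
    linarith
  · rw [← heq]; simp

/-- **THE RATIO LEMMA.** If no `(t+2)`-subset of `S` contains two distinct members of `𝒞`, then
`#punct (t+1) · #rowsOf (t+1) ≤ #punct (t+2) · #rowsOf t`. -/
theorem card_punct_mul_card_rowsOf_le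
    (hone : ∀ Y ⊆ S, Y.card = t + 2 → ∀ C ∈ 𝒞, ∀ C' ∈ 𝒞, C ⊆ Y → C' ⊆ Y → C = C') :
    (punct S (t + 1) 𝒞).card * (rowsOf S (t + 1) 𝒞).card ≤ (punct S (t + 2) 𝒞).card * (rowsOf S t 𝒞).card := by
  have hL : (ratioL S 𝒞 t).card = (punct S (t + 1) 𝒞).card * (rowsOf S (t + 1) 𝒞).card := card_product _ _
  have hR : (ratioR S 𝒞 t).card = (punct S (t + 2) 𝒞).card * (rowsOf S t 𝒞).card := card_product _ _
  rw [← hL, ← hR]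
  have key : ((ratioL S 𝒞 t).card : ℚ) ≤ (ratioR S 𝒞 t).card := by
    rw [← sum_ratioE_ratioW]
    rw [← sum_fiberwise_of_maps_to (s := ratioE S 𝒞 t) (t := ratioR S 𝒞 t) (g := ratioMove)
      (fun e he => ratioMove_mem he)]
    calc ∑ p' ∈ ratioR S 𝒞 t, ∑ e ∈ (ratioE S 𝒞 t).filter (fun e => ratioMove e = p'), ratioW t e
        ≤ ∑ p' ∈ ratioR S 𝒞 t, (1 : ℚ) := sum_le_sum (fun p' hp' => sum_fiber_ratioW_le_one hone hp')
      _ = (ratioR S 𝒞 t).card := by simp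
  exact_mod_cast key

/-- **The chain.** Adjacent ratio steps on `[a, b]` chain to every pair of levels: if `q s · r (s+1) ≤ q (s+1) · r s` for
`a ≤ s < b` and `r > 0` on `[a, b]`, then `q s · r s' ≤ q s' · r s` for `a ≤ s ≤ s' ≤ b`. -/
theorem ratio_chain (r q : ℕ → ℚ) (a b : ℕ) (hr : ∀ s, a ≤ s → s ≤ b → 0 < r s)
    (hstep : ∀ s, a ≤ s → s < b → q s * r (s + 1) ≤ q (s + 1) * r s) :
    ∀ s s', a ≤ s → s ≤ s' → s' ≤ b → q s * r s' ≤ q s' * r s := by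
  intro s s' has hss' hs'b
  obtain ⟨d, hd⟩ : ∃ d, s' = s + d := ⟨s' - s, by omega⟩
  subst hd
  induction d with
  | zero => simp
  | succ d ih =>
    have ih' := ih (by omega) (by omega)
    have hst := hstep (s + d) (by omega) (by omega)
    have hr1 := hr (s + d) (by omega) (by omega)
    have hr2 := hr (s + d + 1) (by omega) (by omega)
    have hr0 := hr s has (by omega)
    -- `q s · r (s+d) · r (s+d+1) ≤ q (s+d) · r s · r (s+d+1) ≤ q (s+d+1) · r (s+d) · r s`
    have h1 : q s * r (s + d) * r (s + d + 1) ≤ q (s + d) * r s * r (s + d + 1) :=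
      mul_le_mul_of_nonneg_right ih' hr2.le
    have h2 : q (s + d) * r (s + d + 1) * r s ≤ q (s + d + 1) * r (s + d) * r s :=
      mul_le_mul_of_nonneg_right hst hr0.le
    have h3 : (q s * r (s + d + 1)) * r (s + d) ≤ (q (s + d + 1) * r s) * r (s + d) := by
      nlinarith [h1, h2]
    rw [show s + (d + 1) = s + d + 1 by omega]
    exact le_of_mul_le_mul_right h3 hr1

/-- The adjacent step in the tree's counts, as rationals. -/
theorem step_ratio (hone : ∀ Y ⊆ S, Y.card = t + 2 → ∀ C ∈ 𝒞, ∀ C' ∈ 𝒞, C ⊆ Y → C' ⊆ Y → C = C') :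
    ((punct S (t + 1) 𝒞).card : ℚ) * (rowsOf S (t + 1) 𝒞).card
      ≤ ((punct S (t + 2) 𝒞).card : ℚ) * (rowsOf S t 𝒞).card := by
  exact_mod_cast card_punct_mul_card_rowsOf_le hone

/-- **The ratio hypothesis of the node lemma.** For the other members `𝒞` of a node at level `ℓ` on the ground set
`S` (no `(ℓ+1)`-subset contains two members; every layer has rows), the member columns per row
`q t = #punct S (t+1) 𝒞` over `r t = #rowsOf S t 𝒞` increase with the level `t = ℓ − c`, `c < m` — exactly the
hypothesis `hq` of `NodeArith.second_family`. -/
theorem ratio_hq {ℓ m : ℕ} (hmℓ : m ≤ ℓ)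
    (hone : ∀ Y ⊆ S, Y.card ≤ ℓ + 1 → ∀ C ∈ 𝒞, ∀ C' ∈ 𝒞, C ⊆ Y → C' ⊆ Y → C = C')
    (hr : ∀ c, c < m → 0 < ((rowsOf S (ℓ - c) 𝒞).card : ℚ)) :
    ∀ c c', c ≤ c' → c' < m →
      ((punct S (ℓ - c' + 1) 𝒞).card : ℚ) * (rowsOf S (ℓ - c) 𝒞).card
        ≤ ((punct S (ℓ - c + 1) 𝒞).card : ℚ) * (rowsOf S (ℓ - c') 𝒞).card := by
  intro c c' hcc' hc'm
  have := ratio_chain (fun s => ((rowsOf S s 𝒞).card : ℚ)) (fun s => ((punct S (s + 1) 𝒞).card : ℚ))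
    (ℓ - (m - 1)) ℓ
    (fun s hs1 hs2 => by
      have := hr (ℓ - s) (by omega)
      rw [show ℓ - (ℓ - s) = s by omega] at this
      exact this)
    (fun s hs1 hs2 => by
      have h := step_ratio (S := S) (𝒞 := 𝒞) (t := s) (fun Y hY hYc => hone Y hY (by omega))
      simpa using h)
    (ℓ - c') (ℓ - c) (by omega) (by omega) (by omega)
  simpa using this

end Ratio

end PercRepro.PuncturedLYM.Split
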